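import Summits.CriticalPhenomena.CardyFormulaZ2.Theorems.CardyComplexConeSLESixFamiliesGiveCardySmoothMarkFamiliesPart2
import Literature.Probability.LatticeModels.MeshDomainJordan
import HarnessLib

/-!
# drefute gen-7 — registered helper `smoothMark_part8` (STUB F, part 8/10): candidate proof

`smoothMark_part8` (registered 2026-08-16T05:17Z): the frame box
`{|a - α| ≤ R/4, b - G α ∈ [3R/8, R/2]}` above a `1`-Lipschitz graph mark lies in `meshDomain D.carrier δ`
for all small `δ > 0`.  Proof: the box is a compact subset of `D.carrier` (it sits inside the chart ball,
`dist² ≤ 5R²/16 < R²`, and strictly above the graph, `G a ≤ G α + R/4 < G α + 3R/8 ≤ b`), so the bulk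
theorem `JordanDomain.exists_forall_mem_meshDomain_and_reachable` applies.  The hypotheses
`s = ±1`, `t = ±1`, `U = …`, `V = …` are used only to rewrite `meshPoint δ x` in frame coordinates;
`Monotone G` is (rightly) absent.
-/

noncomputable section

open Set Metric
open Literature.Probability Literature.Probability.RandomPlanarGeometry
  Literature.Probability.LatticeModels

namespace Summit.CriticalPhenomena.CardyFormulaZ2.Cruxes.SLESixFamiliesGiveCardy.CollarTouchSandwich
namespace DrefuteG7

/-- **`smoothMark_part8` verbatim (registered signature).** -/
theorem smoothMark_part8_proof : ∀ (D : DobrushinDomain) (i : Fin 2) (k : Fin 2) (s t : ℤ) (U V : ℂ) (G : ℝ → ℝ) (α R : ℝ), (s = 1 ∨ s = -1) → (t = 1 ∨ t = -1) → U = Site.toComplex (Pi.single k s) → V = Site.toComplex (Pi.single k.rev t) → D.pt i = (α : ℂ) * U + ((G α : ℝ) : ℂ) * V → (∀ a b, |G a - G b| ≤ |a - b|) → (∀ a b : ℝ, dist ((a : ℂ) * U + (b : ℂ) * V) (D.pt i) < R → ((a : ℂ) * U + (b : ℂ) * V ∈ D.carrier ↔ G a < b)) → 0 < R → ∃ δ₀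 > 0, ∀ δ : ℝ, 0 < δ → δ < δ₀ → ∀ x : Site 2, |δ * (s * x k) - α| ≤ R / 4 → 3 * R / 8 ≤ δ * (t * x k.rev) - G α → δ * (t * x k.rev) - G α ≤ R / 2 → x ∈ meshDomain D.carrier δ := by
  intro D i k s t U V G α R hs ht hU hV hpt hLip hmem hR
  -- the frame box, as a compact subset of `D.carrier`
  set F : ℝ × ℝ → ℂ := fun q => (q.1 : ℂ) * U + (q.2 : ℂ) * V with hF
  have hFc : Continuous F := by
    simp only [hF]
    fun_prop
  set K : Set ℂ := F '' (Icc (α - R / 4) (α + R / 4) ×ˢ Icc (G α + 3 * R / 8) (G α + R / 2)) with hK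
  have hKc : IsCompact K := (isCompact_Icc.prod isCompact_Icc).image hFc
  have hbox : ∀ a b : ℝ, |a - α| ≤ R / 4 → 3 * R / 8 ≤ b - G α → b - G α ≤ R / 2 →
      (a : ℂ) * U + (b : ℂ) * V ∈ D.carrier := by
    intro a b ha hb1 hb2
    have hd2 := SmoothMark.dist_sq_frame hs ht hU hV a b α (G α)
    have hlt : dist ((a : ℂ) * U + (b : ℂ) * V) (D.pt i) < R := by
      rw [hpt]
      have hsq : dist ((a : ℂ) * U + (b : ℂ) * V) ((α : ℂ) * U + ((G α : ℝ) : ℂ) * V) ^ 2 < R ^ 2 := by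
        rw [hd2]
        have h1 : (a - α) ^ 2 ≤ (R / 4) ^ 2 := by
          rw [← sq_abs]; exact pow_le_pow_left₀ (abs_nonneg _) ha 2
        have h2 : (b - G α) ^ 2 ≤ (R / 2) ^ 2 := by
          exact pow_le_pow_left₀ (by linarith) hb2 2
        nlinarith
      exact lt_of_pow_lt_pow_left₀ 2 hR.le hsq
    refine (hmem a b hlt).2 ?_
    have hG : G a - G α ≤ |a - α| := (le_abs_self _).trans (hLip a α)
    linarith
  have hKΩ : K ⊆ D.carrier := by
    rintro _ ⟨⟨a, b⟩, ⟨ha, hb⟩, rfl⟩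
    simp only [mem_Icc] at ha hb
    exact hbox a b (abs_le.2 ⟨by linarith, by linarith⟩) (by linarith) (by linarith)
  obtain ⟨δ₀, hδ₀, H⟩ := D.toJordanDomain.exists_forall_mem_meshDomain_and_reachable hKc hKΩ
  refine ⟨δ₀, hδ₀, fun δ hδ hδ' x h1 h2 h3 => (H δ hδ hδ').1 x ?_⟩
  rw [SmoothMark.meshPoint_eq_frame hs ht hU hV δ x]
  refine ⟨(δ * (s * x k), δ * (t * x k.rev)), ⟨?_, ?_⟩, rfl⟩
  · exact mem_Icc.2 ⟨by linarith [(abs_le.1 h1).1], by linarith [(abs_le.1 h1).2]⟩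
  · exact mem_Icc.2 ⟨by linarith, by linarith⟩

end DrefuteG7
end Summit.CriticalPhenomena.CardyFormulaZ2.Cruxes.SLESixFamiliesGiveCardy.CollarTouchSandwich

end
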